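import Mathlib
import Summits.ValiantsHypothesis.ValiantsHypothesis.Theorems.ValuativeGCTValuativeFlipBlockBorder

/-!
# Block form and `ε`-expansion of the border family at a block-structured coefficient function
# (crux `ValuativeGCT.ValuativeFlip`, stmt-ValiantsHypothesis-12624; wall-breaker axis k8 gen 1, seat 2)

Helper file (`--supports stmt-ValiantsHypothesis-12624`), line `four-row-count`, step D of the size transfer
`N ↦ N+3` (AXIS k8g1 seat 2): for a coefficient function `t` whose block-1 part (indices `< N₁`, border index
`N₁+3`) is arbitrary, whose block-2 part (indices `N₁ .. N₁+2` and their border cells) is `e · c₂`, and whose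
cross cells vanish, the pencil matrix is `B₁ ⊕ (C e) • B₂⁰` after `finSumFinEquiv`, the bordered pencil is the
bordered block-diagonal matrix of `…BlockBorder`, and every border-family member (in the matrix form of
`mf_borderFamily_eq`, `…BorderMatrixForm`) is `C(e³) · (H + C e · K)` with the explicit lowest-order terms `H` of AXIS §1 D.
[this crux, line four-row-count; folklore]
-/

set_option linter.dupNamespace false
set_option maxHeartbeats 1600000

namespace Summit.ValiantsHypothesis.ValiantsHypothesis.Theorems.ValuativeFlip

open scoped BigOperators
open MvPolynomial Matrix

section Spec

variable {S : Type*} [CommRing S]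

/-- Scaling a matrix and the replacing row by the same scalar. [folklore] -/
theorem sp_updateRow_smul {ι : Type*} [DecidableEq ι] {A : Type*} [CommRing A] (c : A) (M : Matrix ι ι A) (k : ι) (v : ι → A) :
    (c • M).updateRow k (c • v) = c • M.updateRow k v := by
  ext i j
  by_cases h : i = k
  · subst h; simp
  · simp [h]

/-- Scaling a matrix and the replacing column by the same scalar. [folklore] -/
theorem sp_updateCol_smul {ι : Type*} [DecidableEq ι] {A : Type*} [CommRing A] (c : A) (M : Matrix ι ι A) (l : ι) (u : ι → A) :
    (c • M).updateCol l (c • u) = c • M.updateCol l u := by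
  ext i j
  by_cases h : j = l
  · subst h; simp
  · simp [h]

/-- Scaling a bordered matrix. [folklore] -/
theorem sp_border_smul {ι : Type*} {A : Type*} [CommRing A] (c : A) (D : Matrix ι ι A) (u v : ι → A) :
    Matrix.fromBlocks (c • D) (Matrix.of fun (i : ι) (_ : Unit) => (c • u) i) (Matrix.of fun (_ : Unit) (j : ι) => (c • v) j)
      (0 : Matrix Unit Unit A) =
    c • Matrix.fromBlocks D (Matrix.of fun (i : ι) (_ : Unit) => u i) (Matrix.of fun (_ : Unit) (j : ι) => v j) (0 : Matrix Unit Unit A) := by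
  ext i j
  rcases i with i | i <;> rcases j with j | j <;> simp

/-- **Block form of the pencil**: after `finSumFinEquiv`, the `(N₁+3) × (N₁+3)` pencil of a block-structured
coefficient function is `B₁ ⊕ (C e) • B₂⁰`. [this crux] -/
theorem sp_pencil_blockForm (t c₂ : ℕ → ℕ → Fin 3 → S) (e : S) (n₁ N₁ : ℕ) (hN₁ : n₁ + 1 ≤ N₁) (h22 : ∀ (i j : ℕ) (s : Fin 3), i < 3 → j < 3 → i ≠ j → t (N₁ + i) (N₁ + j) s = e * c₂ i j s) (h12 : ∀ (i j : ℕ) (s : Fin 3), i < N₁ → j < 3 → t i (N₁ + j) s = 0) (h21 : ∀ (i j : ℕ) (s : Fin 3), i < 3 → j < N₁ → t (N₁ + i) j s = 0) :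
    ((Matrix.of fun i j : Fin (N₁ + 3) => (fun ij : Fin (N₁ + 3) × Fin (N₁ + 3) => ∑ s : Fin 3, (if ((ij.1 : ℕ) = (ij.2 : ℕ) ∧ n₁ + 1 ≤ (ij.1 : ℕ)) then (0 : S) else t (ij.1 : ℕ) (ij.2 : ℕ) s) • (X s : MvPolynomial (Fin 3) S)) (i, j))).submatrix (finSumFinEquiv : Fin N₁ ⊕ Fin 3 ≃ Fin (N₁ + 3)) (finSumFinEquiv : Fin N₁ ⊕ Fin 3 ≃ Fin (N₁ + 3)) = Matrix.fromBlocks (Matrix.of fun i j : Fin (N₁) => (fun ij : Fin (N₁) × Fin (N₁) => ∑ s : Fin 3, (if ((ij.1 : ℕ) = (ij.2 : ℕ) ∧ n₁ + 1 ≤ (ij.1 : ℕ)) then (0 : S) else t (ij.1 : ℕ) (ij.2 : ℕ) s) • (X s : MvPolynomial (Fin 3) S)) (i, j)) 0 0 ((C e : MvPolynomial (Fin 3) S) • (Matrix.of fun i j : Fin 3 => ∑ s : Fin 3, (if i = j then (0 : S) else c₂ (i : ℕ) (j : ℕ) s) • (X s : MvPolynomial (Fin 3) S))) := by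
  ext i j
  rcases i with i | i <;> rcases j with j | j
  · simp [Matrix.submatrix_apply]
  · have h0 : ∀ s : Fin 3, t (i : ℕ) (N₁ + (j : ℕ)) s = 0 := fun s => h12 i j s i.isLt j.isLt
    simp [Matrix.submatrix_apply, h0]
  · have h0 : ∀ s : Fin 3, t (N₁ + (i : ℕ)) (j : ℕ) s = 0 := fun s => h21 i j s i.isLt j.isLt
    simp [Matrix.submatrix_apply, h0]
  · by_cases hij : i = j
    · subst hij
      have hlt : n₁ < N₁ + (i : ℕ) := by omega
      simp [Matrix.submatrix_apply, hlt]
    · have hij' : (i : ℕ) ≠ (j : ℕ) := fun h => hij (Fin.ext h)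
      have hv : ∀ s : Fin 3, t (N₁ + (i : ℕ)) (N₁ + (j : ℕ)) s = e * c₂ i j s :=
        fun s => h22 i j s i.isLt j.isLt hij'
      simp [Matrix.submatrix_apply, hv, hij, hij', Finset.mul_sum, smul_eq_C_mul, mul_assoc]

/-- Block form of the border row. [this crux] -/
theorem sp_vrow_blockForm (t c₂ : ℕ → ℕ → Fin 3 → S) (e : S) (N₁ : ℕ) (h2r : ∀ (j : ℕ) (s : Fin 3), j < 3 → t (N₁ + 3) (N₁ + j) s = e * c₂ 3 j s) :
    (fun j => (fun l : Fin (N₁ + 3) => ∑ s : Fin 3, t (N₁ + 3) ((l : Fin (N₁ + 3)) : ℕ) s • (X s : MvPolynomial (Fin 3) S)) ((finSumFinEquiv : Fin N₁ ⊕ Fin 3 ≃ Fin (N₁ + 3)) j)) = Sum.elim (fun l : Fin N₁ => ∑ s : Fin 3, t (N₁ + 3) ((l : Fin N₁) : ℕ) s • (X s : MvPolynomial (Fin 3) S)) ((C e : MvPolynomial (Fin 3) S) • (fun l : Fin 3 => ∑ s : Fin 3, c₂ 3 ((l : Fin 3) : ℕ) s • (X s : MvPolynomial (Fin 3) S)))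 := by
  funext j
  rcases j with j | j
  · simp
  · have hv : ∀ s : Fin 3, t (N₁ + 3) (N₁ + (j : ℕ)) s = e * c₂ 3 j s := fun s => h2r j s j.isLt
    simp [hv, Finset.mul_sum, smul_eq_C_mul, mul_assoc]

/-- Block form of the border column. [this crux] -/
theorem sp_ucol_blockForm (t c₂ : ℕ → ℕ → Fin 3 → S) (e : S) (N₁ : ℕ) (h2c : ∀ (i : ℕ) (s : Fin 3), i < 3 → t (N₁ + i) (N₁ + 3) s = e * c₂ i 3 s) :
    (fun i => (fun i : Fin (N₁ + 3) => ∑ s : Fin 3, t ((i : Fin (N₁ + 3)) : ℕ) (N₁ + 3) s • (X s : MvPolynomial (Fin 3) S)) ((finSumFinEquiv : Fin N₁ ⊕ Fin 3 ≃ Fin (N₁ + 3)) i)) = Sum.elim (fun i : Fin N₁ => ∑ s : Fin 3, t ((i : Fin N₁) : ℕ) (N₁ + 3) s • (X s : MvPolynomial (Fin 3) S)) ((C e : MvPolynomial (Fin 3) S) • (fun i : Fin 3 => ∑ s : Fin 3, c₂ ((i : Fin 3) : ℕ) 3 s • (X s : MvPolynomial (Fin 3) S))) := by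
  funext i
  rcases i with i | i
  · simp
  · have hu : ∀ s : Fin 3, t (N₁ + (i : ℕ)) (N₁ + 3) s = e * c₂ i 3 s := fun s => h2c i s i.isLt
    simp [hu, Finset.mul_sum, smul_eq_C_mul, mul_assoc]

/-- Values of the three-block reindexing `(Fin N₁ ⊕ Fin 3) ⊕ Unit ≃ Fin (N₁+3+1)`. [folklore] -/
theorem sp_ge_val_inl_inl (N₁ : ℕ) (i : Fin N₁) : (((((finSumFinEquiv : Fin N₁ ⊕ Fin 3 ≃ Fin (N₁ + 3)).sumCongr (Equiv.ofUnique Unit (Fin 1))).trans (finSumFinEquiv : Fin (N₁ + 3) ⊕ Fin 1 ≃ Fin (N₁ + 3 + 1)))) (Sum.inl (Sum.inl i)) : ℕ) = (i : ℕ) := by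
  simp
/-- Second block. [folklore] -/
theorem sp_ge_val_inl_inr (N₁ : ℕ) (j : Fin 3) : (((((finSumFinEquiv : Fin N₁ ⊕ Fin 3 ≃ Fin (N₁ + 3)).sumCongr (Equiv.ofUnique Unit (Fin 1))).trans (finSumFinEquiv : Fin (N₁ + 3) ⊕ Fin 1 ≃ Fin (N₁ + 3 + 1)))) (Sum.inl (Sum.inr j)) : ℕ) = N₁ + (j : ℕ) := by
  simp
/-- Border index. [folklore] -/
theorem sp_ge_inr (N₁ : ℕ) : ((((finSumFinEquiv : Fin N₁ ⊕ Fin 3 ≃ Fin (N₁ + 3)).sumCongr (Equiv.ofUnique Unit (Fin 1))).trans (finSumFinEquiv : Fin (N₁ + 3) ⊕ Fin 1 ≃ Fin (N₁ + 3 + 1)))) (Sum.inr ()) = Fin.last (N₁ + 3) := by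
  apply Fin.ext
  simp [Fin.val_last]
/-- Block-1 indices go to `castSucc ∘ castAdd`. [folklore] -/
theorem sp_ge_inl_inl (N₁ : ℕ) (i : Fin N₁) : ((((finSumFinEquiv : Fin N₁ ⊕ Fin 3 ≃ Fin (N₁ + 3)).sumCongr (Equiv.ofUnique Unit (Fin 1))).trans (finSumFinEquiv : Fin (N₁ + 3) ⊕ Fin 1 ≃ Fin (N₁ + 3 + 1)))) (Sum.inl (Sum.inl i)) = Fin.castSucc (((finSumFinEquiv : Fin N₁ ⊕ Fin 3 ≃ Fin (N₁ + 3))) (Sum.inl i)) := by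
  apply Fin.ext
  simp
/-- Block-2 indices go to `castSucc ∘ natAdd`. [folklore] -/
theorem sp_ge_inl_inr (N₁ : ℕ) (j : Fin 3) : ((((finSumFinEquiv : Fin N₁ ⊕ Fin 3 ≃ Fin (N₁ + 3)).sumCongr (Equiv.ofUnique Unit (Fin 1))).trans (finSumFinEquiv : Fin (N₁ + 3) ⊕ Fin 1 ≃ Fin (N₁ + 3 + 1)))) (Sum.inl (Sum.inr j)) = Fin.castSucc (((finSumFinEquiv : Fin N₁ ⊕ Fin 3 ≃ Fin (N₁ + 3))) (Sum.inr j)) := by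
  apply Fin.ext
  simp

/-- **Block form of the bordered pencil**: after the three-block reindexing, the `(N₁+4) × (N₁+4)` pencil is the
bordered block-diagonal matrix of `…BlockBorder`. [this crux] -/
theorem sp_pencil_border_blockForm (t c₂ : ℕ → ℕ → Fin 3 → S) (e : S) (n₁ N₁ : ℕ) (hN₁ : n₁ + 1 ≤ N₁) (h22 : ∀ (i j : ℕ) (s : Fin 3), i < 3 → j < 3 → i ≠ j → t (N₁ + i) (N₁ + j) s = e * c₂ i j s) (h2c : ∀ (i : ℕ) (s : Fin 3), i < 3 → t (N₁ + i) (N₁ + 3) s = e * c₂ i 3 s) (h2r : ∀ (j : ℕ) (s : Fin 3), j < 3 → t (N₁ + 3) (N₁ + j) s = e * c₂ 3 j s) (h12 : ∀ (i j : ℕ) (s : Fin 3), i < N₁ → j < 3 → t i (N₁ + j) s = 0) (h21 : ∀ (i j : ℕ) (s : Fin 3), i < 3 → j < N₁ → t (N₁ + i) j s = 0) :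
    ((Matrix.of fun i j : Fin (N₁ + 3 + 1) => (fun ij : Fin (N₁ + 3 + 1) × Fin (N₁ + 3 + 1) => ∑ s : Fin 3, (if ((ij.1 : ℕ) = (ij.2 : ℕ) ∧ n₁ + 1 ≤ (ij.1 : ℕ)) then (0 : S) else t (ij.1 : ℕ) (ij.2 : ℕ) s) • (X s : MvPolynomial (Fin 3) S)) (i, j))).submatrix (((finSumFinEquiv : Fin N₁ ⊕ Fin 3 ≃ Fin (N₁ + 3)).sumCongr (Equiv.ofUnique Unit (Fin 1))).trans (finSumFinEquiv : Fin (N₁ + 3) ⊕ Fin 1 ≃ Fin (N₁ + 3 + 1))) (((finSumFinEquiv : Fin N₁ ⊕ Fin 3 ≃ Fin (N₁ + 3)).sumCongr (Equiv.ofUnique Unit (Fin 1))).trans (finSumFinEquiv : Fin (N₁ + 3) ⊕ Fin 1 ≃ Fin (N₁ + 3 + 1))) = (Matrix.fromBlocks (Matrix.fromBlocks (Matrix.of fun i j : Fin (N₁) => (fun ij : Fin (N₁) × Fin (N₁) => ∑ s : Fin 3, (if ((ij.1 : ℕ) = (ij.2 : ℕ) ∧ n₁ + 1 ≤ (ij.1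 : ℕ)) then (0 : S) else t (ij.1 : ℕ) (ij.2 : ℕ) s) • (X s : MvPolynomial (Fin 3) S)) (i, j)) 0 0 ((C e : MvPolynomial (Fin 3) S) • (Matrix.of fun i j : Fin 3 => ∑ s : Fin 3, (if i = j then (0 : S) else c₂ (i : ℕ) (j : ℕ) s) • (X s : MvPolynomial (Fin 3) S)))) (Matrix.of fun (i : Fin N₁ ⊕ Fin 3) (_ : Unit) => Sum.elim (fun i : Fin N₁ => ∑ s : Fin 3, t ((i : Fin N₁) : ℕ) (N₁ + 3) s • (X s : MvPolynomial (Fin 3) S)) ((C e : MvPolynomial (Fin 3) S) • (fun i : Fin 3 => ∑ s : Fin 3, c₂ ((i : Fin 3) : ℕ) 3 s • (X s : MvPolynomial (Fin 3) S))) i) (Matrix.of fun (_ : Unit) (j : Fin N₁ ⊕ Fin 3) => Sum.elim (fun l : Fin N₁ => ∑ s : Fin 3, t (N₁ + 3) ((l : Fin N₁) : ℕ) s • (X s : MvPolynomial (Fin 3) S)) ((C e : MvPolynomial (Fin 3) S) • (fun l : Fin 3 => ∑ s : Fin 3, c₂ 3 ((l : Fin 3) : ℕ) s • (X s : MvPolynomial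 (Fin 3) S))) j) (0 : Matrix Unit Unit (MvPolynomial (Fin 3) S))) := by
  ext i j
  have hv1 := sp_ge_val_inl_inl N₁
  have hv2 := sp_ge_val_inl_inr N₁
  have hv3 : (((((finSumFinEquiv : Fin N₁ ⊕ Fin 3 ≃ Fin (N₁ + 3)).sumCongr (Equiv.ofUnique Unit (Fin 1))).trans (finSumFinEquiv : Fin (N₁ + 3) ⊕ Fin 1 ≃ Fin (N₁ + 3 + 1)))) (Sum.inr ()) : ℕ) = N₁ + 3 := by rw [sp_ge_inr]; simp
  rcases i with (i | i) | i <;> rcases j with (j | j) | j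
  · simp only [Matrix.submatrix_apply, Matrix.of_apply, hv1]
    simp
  · have h0 : ∀ s : Fin 3, t (i : ℕ) (N₁ + (j : ℕ)) s = 0 := fun s => h12 i j s i.isLt j.isLt
    simp only [Matrix.submatrix_apply, Matrix.of_apply, hv1, hv2]
    simp [h0]
  · have hne : (i : ℕ) ≠ N₁ + 3 := by have := i.isLt; omega
    simp only [Matrix.submatrix_apply, Matrix.of_apply, hv1, hv3]
    simp [hne]
  · have h0 : ∀ s : Fin 3, t (N₁ + (i : ℕ)) (j : ℕ) s = 0 := fun s => h21 i j s i.isLt j.isLt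
    simp only [Matrix.submatrix_apply, Matrix.of_apply, hv1, hv2]
    simp [h0]
  · simp only [Matrix.submatrix_apply, Matrix.of_apply, hv2]
    by_cases hij : i = j
    · subst hij
      have hlt : n₁ < N₁ + (i : ℕ) := by omega
      simp [hlt]
    · have hij' : (i : ℕ) ≠ (j : ℕ) := fun h => hij (Fin.ext h)
      have hv : ∀ s : Fin 3, t (N₁ + (i : ℕ)) (N₁ + (j : ℕ)) s = e * c₂ i j s :=
        fun s => h22 i j s i.isLt j.isLt hij'
      simp [hv, hij, hij', Finset.mul_sum, smul_eq_C_mul, mul_assoc]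
  · have hne : (i : ℕ) ≠ 3 := by have := i.isLt; omega
    have hu : ∀ s : Fin 3, t (N₁ + (i : ℕ)) (N₁ + 3) s = e * c₂ i 3 s := fun s => h2c i s i.isLt
    simp only [Matrix.submatrix_apply, Matrix.of_apply, hv2, hv3]
    simp [hne, hu, Finset.mul_sum, smul_eq_C_mul, mul_assoc]
  · have hne : N₁ + 3 ≠ (j : ℕ) := by have := j.isLt; omega
    simp only [Matrix.submatrix_apply, Matrix.of_apply, hv1, hv3]
    simp [hne]
  · have hne : (3 : ℕ) ≠ (j : ℕ) := by have := j.isLt; omega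
    have hv : ∀ s : Fin 3, t (N₁ + 3) (N₁ + (j : ℕ)) s = e * c₂ 3 j s := fun s => h2r j s j.isLt
    simp only [Matrix.submatrix_apply, Matrix.of_apply, hv2, hv3]
    simp [hne, hv, Finset.mul_sum, smul_eq_C_mul, mul_assoc]
  · have hle : n₁ ≤ N₁ + 2 := by omega
    simp only [Matrix.submatrix_apply, Matrix.of_apply, hv3]
    simp [hle]

/-- **`ε`-expansion, part (a)**: `y_s · per P = C(e³) · (per B₂⁰ · (y_s · per B₁))`. [this crux] -/
theorem sp_member_a (t c₂ : ℕ → ℕ → Fin 3 → S) (e : S) (n₁ N₁ : ℕ) (hN₁ : n₁ + 1 ≤ N₁) (h22 : ∀ (i j : ℕ) (s : Fin 3), i < 3 → j < 3 → i ≠ j → t (N₁ + i) (N₁ + j) s = e * c₂ i j s) (h12 : ∀ (i j : ℕ) (s : Fin 3), i < N₁ → j < 3 → t i (N₁ + j) s = 0) (h21 : ∀ (i j : ℕ) (s : Fin 3), i < 3 → j < N₁ → t (N₁ + i) j s = 0) (s : Fin 3) : (X s : MvPolynomial (Fin 3) S) * ((Matrix.of fun i j : Fin (N₁ + 3) =>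 (fun ij : Fin (N₁ + 3) × Fin (N₁ + 3) => ∑ s : Fin 3, (if ((ij.1 : ℕ) = (ij.2 : ℕ) ∧ n₁ + 1 ≤ (ij.1 : ℕ)) then (0 : S) else t (ij.1 : ℕ) (ij.2 : ℕ) s) • (X s : MvPolynomial (Fin 3) S)) (i, j))).permanent = C (e ^ 3) * (((Matrix.of fun i j : Fin 3 => ∑ s : Fin 3, (if i = j then (0 : S) else c₂ (i : ℕ) (j : ℕ) s) • (X s : MvPolynomial (Fin 3) S))).permanent * ((X s : MvPolynomial (Fin 3) S) * ((Matrix.of fun i j : Fin (N₁) => (fun ij : Fin (N₁) × Fin (N₁) => ∑ s : Fin 3, (if ((ij.1 : ℕ) = (ij.2 : ℕ) ∧ n₁ + 1 ≤ (ij.1 : ℕ)) then (0 : S) else t (ij.1 : ℕ) (ij.2 : ℕ) s) • (X s : MvPolynomial (Fin 3) S)) (i, j))).permanent) + C e * 0) := by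
  rw [← permanent_submatrix_equiv (finSumFinEquiv : Fin N₁ ⊕ Fin 3 ≃ Fin (N₁ + 3)) (Matrix.of fun i j : Fin (N₁ + 3) => (fun ij : Fin (N₁ + 3) × Fin (N₁ + 3) => ∑ s : Fin 3, (if ((ij.1 : ℕ) = (ij.2 : ℕ) ∧ n₁ + 1 ≤ (ij.1 : ℕ)) then (0 : S) else t (ij.1 : ℕ) (ij.2 : ℕ) s) • (X s : MvPolynomial (Fin 3) S)) (i, j)), sp_pencil_blockForm t c₂ e n₁ N₁ hN₁ h22 h12 h21,
    hb_permanent_fromBlocks_zero₂₁, permanent_smul, map_pow]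
  simp only [Fintype.card_fin]
  ring

/-- **`ε`-expansion, part (b), block-1 row**: `y_s · per(P; row k ← v) = C(e³) · (per B₂⁰ · (y_s · per(B₁; row k ← v¹)))`. [this crux] -/
theorem sp_member_b_inl (t c₂ : ℕ → ℕ → Fin 3 → S) (e : S) (n₁ N₁ : ℕ) (hN₁ : n₁ + 1 ≤ N₁) (h22 : ∀ (i j : ℕ) (s : Fin 3), i < 3 → j < 3 → i ≠ j → t (N₁ + i) (N₁ + j) s = e * c₂ i j s) (h2r : ∀ (j : ℕ) (s : Fin 3), j < 3 → t (N₁ + 3) (N₁ + j) s = e * c₂ 3 j s) (h12 : ∀ (i j : ℕ) (s : Fin 3), i < N₁ → j < 3 → t i (N₁ + j) s = 0) (h21 : ∀ (i j : ℕ) (s : Fin 3), i < 3 → j < N₁ → t (N₁ + i) j s = 0) (s : Fin 3) (k₁ : Fin N₁) :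
    (X s : MvPolynomial (Fin 3) S) * (((Matrix.of fun i j : Fin (N₁ + 3) => (fun ij : Fin (N₁ + 3) × Fin (N₁ + 3) => ∑ s : Fin 3, (if ((ij.1 : ℕ) = (ij.2 : ℕ) ∧ n₁ + 1 ≤ (ij.1 : ℕ)) then (0 : S) else t (ij.1 : ℕ) (ij.2 : ℕ) s) • (X s : MvPolynomial (Fin 3) S)) (i, j))).updateRow ((finSumFinEquiv : Fin N₁ ⊕ Fin 3 ≃ Fin (N₁ + 3)) (Sum.inl k₁)) (fun l : Fin (N₁ + 3) => ∑ s : Fin 3, t (N₁ + 3) ((l : Fin (N₁ + 3)) : ℕ) s • (X s : MvPolynomial (Fin 3) S))).permanent =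
      C (e ^ 3) * (((Matrix.of fun i j : Fin 3 => ∑ s : Fin 3, (if i = j then (0 : S) else c₂ (i : ℕ) (j : ℕ) s) • (X s : MvPolynomial (Fin 3) S))).permanent * ((X s : MvPolynomial (Fin 3) S) * (((Matrix.of fun i j : Fin (N₁) => (fun ij : Fin (N₁) × Fin (N₁) => ∑ s : Fin 3, (if ((ij.1 : ℕ) = (ij.2 : ℕ) ∧ n₁ + 1 ≤ (ij.1 : ℕ)) then (0 : S) else t (ij.1 : ℕ) (ij.2 : ℕ) s) • (X s : MvPolynomial (Fin 3) S)) (i, j))).updateRow k₁ (fun l : Fin N₁ => ∑ s : Fin 3, t (N₁ + 3) ((l : Fin N₁) : ℕ) s • (X s : MvPolynomial (Fin 3) S))).permanent) + C e * 0) := by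
  rw [← permanent_submatrix_equiv (finSumFinEquiv : Fin N₁ ⊕ Fin 3 ≃ Fin (N₁ + 3)), submatrix_updateRow_equiv, sp_pencil_blockForm t c₂ e n₁ N₁ hN₁ h22 h12 h21,
    Equiv.symm_apply_apply, sp_vrow_blockForm t c₂ e N₁ h2r, bb_permanent_updateRow_inl, permanent_smul, map_pow]
  simp only [Fintype.card_fin]
  ring

/-- **`ε`-expansion, part (b), block-2 row**: `y_s · per(P; row k ← v) = C(e³) · ((y_s · per B₁) · per(B₂⁰; row k ← v²⁰))`. [this crux] -/
theorem sp_member_b_inr (t c₂ : ℕ → ℕ → Fin 3 → S) (e : S) (n₁ N₁ : ℕ) (hN₁ : n₁ + 1 ≤ N₁) (h22 : ∀ (i j : ℕ) (s : Fin 3), i < 3 → j < 3 → i ≠ j → t (N₁ + i) (N₁ + j) s = e * c₂ i j s) (h2r : ∀ (j : ℕ) (s : Fin 3), j < 3 → t (N₁ + 3) (N₁ + j) s = e * c₂ 3 j s) (h12 : ∀ (i j : ℕ) (s : Fin 3), i < N₁ → j < 3 → t i (N₁ + j) s = 0) (h21 : ∀ (i j : ℕ) (s : Fin 3), i < 3 →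 j < N₁ → t (N₁ + i) j s = 0) (s : Fin 3) (k₂ : Fin 3) :
    (X s : MvPolynomial (Fin 3) S) * (((Matrix.of fun i j : Fin (N₁ + 3) => (fun ij : Fin (N₁ + 3) × Fin (N₁ + 3) => ∑ s : Fin 3, (if ((ij.1 : ℕ) = (ij.2 : ℕ) ∧ n₁ + 1 ≤ (ij.1 : ℕ)) then (0 : S) else t (ij.1 : ℕ) (ij.2 : ℕ) s) • (X s : MvPolynomial (Fin 3) S)) (i, j))).updateRow ((finSumFinEquiv : Fin N₁ ⊕ Fin 3 ≃ Fin (N₁ + 3)) (Sum.inr k₂)) (fun l : Fin (N₁ + 3) => ∑ s : Fin 3, t (N₁ + 3) ((l : Fin (N₁ + 3)) : ℕ) s • (X s : MvPolynomial (Fin 3) S))).permanent =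
      C (e ^ 3) * (((X s : MvPolynomial (Fin 3) S) * ((Matrix.of fun i j : Fin (N₁) => (fun ij : Fin (N₁) × Fin (N₁) => ∑ s : Fin 3, (if ((ij.1 : ℕ) = (ij.2 : ℕ) ∧ n₁ + 1 ≤ (ij.1 : ℕ)) then (0 : S) else t (ij.1 : ℕ) (ij.2 : ℕ) s) • (X s : MvPolynomial (Fin 3) S)) (i, j))).permanent) * (((Matrix.of fun i j : Fin 3 => ∑ s : Fin 3, (if i = j then (0 : S) else c₂ (i : ℕ) (j : ℕ) s) • (X s : MvPolynomial (Fin 3) S))).updateRow k₂ (fun l : Fin 3 => ∑ s : Fin 3, c₂ 3 ((l : Fin 3) : ℕ) s • (X s : MvPolynomial (Fin 3) S))).permanent + C e * 0) := by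
  rw [← permanent_submatrix_equiv (finSumFinEquiv : Fin N₁ ⊕ Fin 3 ≃ Fin (N₁ + 3)), submatrix_updateRow_equiv, sp_pencil_blockForm t c₂ e n₁ N₁ hN₁ h22 h12 h21,
    Equiv.symm_apply_apply, sp_vrow_blockForm t c₂ e N₁ h2r, bb_permanent_updateRow_inr, sp_updateRow_smul, permanent_smul,
    map_pow]
  simp only [Fintype.card_fin]
  ring

/-- **`ε`-expansion, part (c), block-1 column.** [this crux] -/
theorem sp_member_c_inl (t c₂ : ℕ → ℕ → Fin 3 → S) (e : S) (n₁ N₁ : ℕ) (hN₁ : n₁ + 1 ≤ N₁) (h22 : ∀ (i j : ℕ) (s : Fin 3), i < 3 → j < 3 → i ≠ j → t (N₁ + i) (N₁ + j) s = e * c₂ i j s) (h2c : ∀ (i : ℕ) (s : Fin 3), i < 3 → t (N₁ + i) (N₁ + 3) s = e * c₂ i 3 s) (h12 : ∀ (i j : ℕ) (s : Fin 3), i < N₁ → j < 3 → t i (N₁ + j) s = 0) (h21 : ∀ (i j : ℕ) (s : Fin 3), i < 3 → j < N₁ → t (N₁ + i) j s = 0) (s : Fin 3) (l₁ : Fin N₁)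 :
    (X s : MvPolynomial (Fin 3) S) * (((Matrix.of fun i j : Fin (N₁ + 3) => (fun ij : Fin (N₁ + 3) × Fin (N₁ + 3) => ∑ s : Fin 3, (if ((ij.1 : ℕ) = (ij.2 : ℕ) ∧ n₁ + 1 ≤ (ij.1 : ℕ)) then (0 : S) else t (ij.1 : ℕ) (ij.2 : ℕ) s) • (X s : MvPolynomial (Fin 3) S)) (i, j))).updateCol ((finSumFinEquiv : Fin N₁ ⊕ Fin 3 ≃ Fin (N₁ + 3)) (Sum.inl l₁)) (fun i : Fin (N₁ + 3) => ∑ s : Fin 3, t ((i : Fin (N₁ + 3)) : ℕ) (N₁ + 3) s • (X s : MvPolynomial (Fin 3) S))).permanent =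
      C (e ^ 3) * (((Matrix.of fun i j : Fin 3 => ∑ s : Fin 3, (if i = j then (0 : S) else c₂ (i : ℕ) (j : ℕ) s) • (X s : MvPolynomial (Fin 3) S))).permanent * ((X s : MvPolynomial (Fin 3) S) * (((Matrix.of fun i j : Fin (N₁) => (fun ij : Fin (N₁) × Fin (N₁) => ∑ s : Fin 3, (if ((ij.1 : ℕ) = (ij.2 : ℕ) ∧ n₁ + 1 ≤ (ij.1 : ℕ)) then (0 : S) else t (ij.1 : ℕ) (ij.2 : ℕ) s) • (X s : MvPolynomial (Fin 3) S)) (i, j))).updateCol l₁ (fun i : Fin N₁ => ∑ s : Fin 3, t ((i : Fin N₁) : ℕ) (N₁ + 3) s • (X s : MvPolynomial (Fin 3) S))).permanent) + C e * 0) := by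
  rw [← permanent_submatrix_equiv (finSumFinEquiv : Fin N₁ ⊕ Fin 3 ≃ Fin (N₁ + 3)), submatrix_updateCol_equiv, sp_pencil_blockForm t c₂ e n₁ N₁ hN₁ h22 h12 h21,
    Equiv.symm_apply_apply, sp_ucol_blockForm t c₂ e N₁ h2c, bb_permanent_updateCol_inl, permanent_smul, map_pow]
  simp only [Fintype.card_fin]
  ring

/-- **`ε`-expansion, part (c), block-2 column.** [this crux] -/
theorem sp_member_c_inr (t c₂ : ℕ → ℕ → Fin 3 → S) (e : S) (n₁ N₁ : ℕ) (hN₁ : n₁ + 1 ≤ N₁) (h22 : ∀ (i j : ℕ) (s : Fin 3), i < 3 → j < 3 → i ≠ j → t (N₁ + i) (N₁ + j) s = e * c₂ i j s) (h2c : ∀ (i : ℕ) (s : Fin 3), i < 3 → t (N₁ + i) (N₁ + 3) s = e * c₂ i 3 s) (h12 : ∀ (i j : ℕ) (s : Fin 3), i < N₁ → j < 3 → t i (N₁ + j) s = 0) (h21 : ∀ (i j : ℕ) (s : Fin 3), i < 3 → j < N₁ → t (N₁ + i) j s = 0) (s : Fin 3) (l₂ : Fin 3) :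
    (X s : MvPolynomial (Fin 3) S) * (((Matrix.of fun i j : Fin (N₁ + 3) => (fun ij : Fin (N₁ + 3) × Fin (N₁ + 3) => ∑ s : Fin 3, (if ((ij.1 : ℕ) = (ij.2 : ℕ) ∧ n₁ + 1 ≤ (ij.1 : ℕ)) then (0 : S) else t (ij.1 : ℕ) (ij.2 : ℕ) s) • (X s : MvPolynomial (Fin 3) S)) (i, j))).updateCol ((finSumFinEquiv : Fin N₁ ⊕ Fin 3 ≃ Fin (N₁ + 3)) (Sum.inr l₂)) (fun i : Fin (N₁ + 3) => ∑ s : Fin 3, t ((i : Fin (N₁ + 3)) : ℕ) (N₁ + 3) s • (X s : MvPolynomial (Fin 3) S))).permanent =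
      C (e ^ 3) * (((X s : MvPolynomial (Fin 3) S) * ((Matrix.of fun i j : Fin (N₁) => (fun ij : Fin (N₁) × Fin (N₁) => ∑ s : Fin 3, (if ((ij.1 : ℕ) = (ij.2 : ℕ) ∧ n₁ + 1 ≤ (ij.1 : ℕ)) then (0 : S) else t (ij.1 : ℕ) (ij.2 : ℕ) s) • (X s : MvPolynomial (Fin 3) S)) (i, j))).permanent) * (((Matrix.of fun i j : Fin 3 => ∑ s : Fin 3, (if i = j then (0 : S) else c₂ (i : ℕ) (j : ℕ) s) • (X s : MvPolynomial (Fin 3) S))).updateCol l₂ (fun i : Fin 3 => ∑ s : Fin 3, c₂ ((i : Fin 3) : ℕ) 3 s • (X s : MvPolynomial (Fin 3) S))).permanent + C e * 0) := by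
  rw [← permanent_submatrix_equiv (finSumFinEquiv : Fin N₁ ⊕ Fin 3 ≃ Fin (N₁ + 3)), submatrix_updateCol_equiv, sp_pencil_blockForm t c₂ e n₁ N₁ hN₁ h22 h12 h21,
    Equiv.symm_apply_apply, sp_ucol_blockForm t c₂ e N₁ h2c, bb_permanent_updateCol_inr, sp_updateCol_smul, permanent_smul,
    map_pow]
  simp only [Fintype.card_fin]
  ring

/-- **`ε`-expansion, part (d), block-1 row**: `per(P⁺; row k ← row N) = C(e³)·(per B₂⁰ · Z¹_k + C e · (2 R¹_k Λ₂⁰))`. [this crux] -/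
theorem sp_member_d_inl (t c₂ : ℕ → ℕ → Fin 3 → S) (e : S) (n₁ N₁ : ℕ) (hN₁ : n₁ + 1 ≤ N₁) (h22 : ∀ (i j : ℕ) (s : Fin 3), i < 3 → j < 3 → i ≠ j → t (N₁ + i) (N₁ + j) s = e * c₂ i j s) (h2c : ∀ (i : ℕ) (s : Fin 3), i < 3 → t (N₁ + i) (N₁ + 3) s = e * c₂ i 3 s) (h2r : ∀ (j : ℕ) (s : Fin 3), j < 3 → t (N₁ + 3) (N₁ + j) s = e * c₂ 3 j s) (h12 : ∀ (i j : ℕ) (s : Fin 3), i < N₁ → j < 3 → t i (N₁ + j) s = 0) (h21 : ∀ (i j : ℕ) (s : Fin 3), i < 3 → j < N₁ → t (N₁ + i) j s = 0) (k₁ : Fin N₁) :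
    (((Matrix.of fun i j : Fin (N₁ + 3 + 1) => (fun ij : Fin (N₁ + 3 + 1) × Fin (N₁ + 3 + 1) => ∑ s : Fin 3, (if ((ij.1 : ℕ) = (ij.2 : ℕ) ∧ n₁ + 1 ≤ (ij.1 : ℕ)) then (0 : S) else t (ij.1 : ℕ) (ij.2 : ℕ) s) • (X s : MvPolynomial (Fin 3) S)) (i, j))).updateRow (Fin.castSucc ((finSumFinEquiv : Fin N₁ ⊕ Fin 3 ≃ Fin (N₁ + 3)) (Sum.inl k₁))) (((Matrix.of fun i j : Fin (N₁ + 3 + 1) => (fun ij : Fin (N₁ + 3 + 1) × Fin (N₁ + 3 + 1) => ∑ s : Fin 3, (if ((ij.1 : ℕ) = (ij.2 : ℕ) ∧ n₁ + 1 ≤ (ij.1 : ℕ)) then (0 : S) else t (ij.1 : ℕ) (ij.2 : ℕ) s) • (X s : MvPolynomial (Fin 3) S)) (i, j))) (Fin.last (N₁ + 3)))).permanent =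
      C (e ^ 3) * (((Matrix.of fun i j : Fin 3 => ∑ s : Fin 3, (if i = j then (0 : S) else c₂ (i : ℕ) (j : ℕ) s) • (X s : MvPolynomial (Fin 3) S))).permanent * (((Matrix.fromBlocks (Matrix.of fun i j : Fin (N₁) => (fun ij : Fin (N₁) × Fin (N₁) => ∑ s : Fin 3, (if ((ij.1 : ℕ) = (ij.2 : ℕ) ∧ n₁ + 1 ≤ (ij.1 : ℕ)) then (0 : S) else t (ij.1 : ℕ) (ij.2 : ℕ) s) • (X s : MvPolynomial (Fin 3) S)) (i, j)) (Matrix.of fun (i : Fin N₁) (_ : Unit) => (fun i : Fin N₁ => ∑ s : Fin 3, t ((i : Fin N₁) : ℕ) (N₁ + 3) s • (X s : MvPolynomial (Fin 3) S)) i) (Matrix.of fun (_ : Unit) (j : Fin N₁) => (fun l : Fin N₁ => ∑ s : Fin 3, t (N₁ + 3) ((l : Fin N₁) : ℕ) s • (X s : MvPolynomial (Fin 3) S)) j) (0 : Matrix Unit Unit (MvPolynomial (Fin 3) S)))).updateRow (Sum.inl k₁) (((Matrix.fromBlocks (Matrix.of fun i j : Fin (N₁) => (fun ij : Fin (N₁)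 × Fin (N₁) => ∑ s : Fin 3, (if ((ij.1 : ℕ) = (ij.2 : ℕ) ∧ n₁ + 1 ≤ (ij.1 : ℕ)) then (0 : S) else t (ij.1 : ℕ) (ij.2 : ℕ) s) • (X s : MvPolynomial (Fin 3) S)) (i, j)) (Matrix.of fun (i : Fin N₁) (_ : Unit) => (fun i : Fin N₁ => ∑ s : Fin 3, t ((i : Fin N₁) : ℕ) (N₁ + 3) s • (X s : MvPolynomial (Fin 3) S)) i) (Matrix.of fun (_ : Unit) (j : Fin N₁) => (fun l : Fin N₁ => ∑ s : Fin 3, t (N₁ + 3) ((l : Fin N₁) : ℕ) s • (X s : MvPolynomial (Fin 3) S)) j) (0 : Matrix Unit Unit (MvPolynomial (Fin 3) S)))) (Sum.inr ()))).permanent +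
        C e * (2 * (((Matrix.of fun i j : Fin (N₁) => (fun ij : Fin (N₁) × Fin (N₁) => ∑ s : Fin 3, (if ((ij.1 : ℕ) = (ij.2 : ℕ) ∧ n₁ + 1 ≤ (ij.1 : ℕ)) then (0 : S) else t (ij.1 : ℕ) (ij.2 : ℕ) s) • (X s : MvPolynomial (Fin 3) S)) (i, j))).updateRow k₁ (fun l : Fin N₁ => ∑ s : Fin 3, t (N₁ + 3) ((l : Fin N₁) : ℕ) s • (X s : MvPolynomial (Fin 3) S))).permanent * ((Matrix.fromBlocks (Matrix.of fun i j : Fin 3 => ∑ s : Fin 3, (if i = j then (0 : S) else c₂ (i : ℕ) (j : ℕ) s) • (X s : MvPolynomial (Fin 3) S)) (Matrix.of fun (i : Fin 3) (_ : Unit) => (fun i : Fin 3 => ∑ s : Fin 3, c₂ ((i : Fin 3) : ℕ) 3 s • (X s : MvPolynomial (Fin 3) S)) i) (Matrix.of fun (_ : Unit) (j : Fin 3) => (fun l : Fin 3 => ∑ s : Fin 3, c₂ 3 ((l : Fin 3) : ℕ) s • (X s : MvPolynomial (Fin 3) S)) j) (0 : Matrix Unit Unit (MvPolynomial (Fin 3)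 S)))).permanent)) := by
  have hform := sp_pencil_border_blockForm t c₂ e n₁ N₁ hN₁ h22 h2c h2r h12 h21
  have hrow : (fun j => ((Matrix.of fun i j : Fin (N₁ + 3 + 1) => (fun ij : Fin (N₁ + 3 + 1) × Fin (N₁ + 3 + 1) => ∑ s : Fin 3, (if ((ij.1 : ℕ) = (ij.2 : ℕ) ∧ n₁ + 1 ≤ (ij.1 : ℕ)) then (0 : S) else t (ij.1 : ℕ) (ij.2 : ℕ) s) • (X s : MvPolynomial (Fin 3) S)) (i, j))) (Fin.last (N₁ + 3)) (((((finSumFinEquiv : Fin N₁ ⊕ Fin 3 ≃ Fin (N₁ + 3)).sumCongr (Equiv.ofUnique Unit (Fin 1))).trans (finSumFinEquiv : Fin (N₁ + 3) ⊕ Fin 1 ≃ Fin (N₁ + 3 + 1)))) j)) = ((Matrix.fromBlocks (Matrix.fromBlocks (Matrix.of fun i j : Fin (N₁) => (fun ij : Fin (N₁) × Fin (N₁) => ∑ s : Fin 3, (if ((ij.1 : ℕ) = (ij.2 : ℕ) ∧ n₁ + 1 ≤ (ij.1 : ℕ)) then (0 : S) else t (ij.1 : ℕ) (ij.2 : ℕ)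 s) • (X s : MvPolynomial (Fin 3) S)) (i, j)) 0 0 ((C e : MvPolynomial (Fin 3) S) • (Matrix.of fun i j : Fin 3 => ∑ s : Fin 3, (if i = j then (0 : S) else c₂ (i : ℕ) (j : ℕ) s) • (X s : MvPolynomial (Fin 3) S)))) (Matrix.of fun (i : Fin N₁ ⊕ Fin 3) (_ : Unit) => Sum.elim (fun i : Fin N₁ => ∑ s : Fin 3, t ((i : Fin N₁) : ℕ) (N₁ + 3) s • (X s : MvPolynomial (Fin 3) S)) ((C e : MvPolynomial (Fin 3) S) • (fun i : Fin 3 => ∑ s : Fin 3, c₂ ((i : Fin 3) : ℕ) 3 s • (X s : MvPolynomial (Fin 3) S))) i) (Matrix.of fun (_ : Unit) (j : Fin N₁ ⊕ Fin 3) => Sum.elim (fun l : Fin N₁ => ∑ s : Fin 3, t (N₁ + 3) ((l : Fin N₁) : ℕ) s • (X s : MvPolynomial (Fin 3) S)) ((C e : MvPolynomial (Fin 3) S) • (fun l : Fin 3 => ∑ s : Fin 3, c₂ 3 ((l : Fin 3) : ℕ) s • (X s : MvPolynomial (Fin 3) S))) j) (0 : Matrix Unit Unit (MvPolynomial (Fin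 3) S)))) (Sum.inr ()) := by
    rw [← hform]
    funext j
    simp only [Matrix.submatrix_apply, sp_ge_inr]
  rw [← permanent_submatrix_equiv (((finSumFinEquiv : Fin N₁ ⊕ Fin 3 ≃ Fin (N₁ + 3)).sumCongr (Equiv.ofUnique Unit (Fin 1))).trans (finSumFinEquiv : Fin (N₁ + 3) ⊕ Fin 1 ≃ Fin (N₁ + 3 + 1))), submatrix_updateRow_equiv, hform, ← sp_ge_inl_inl N₁ k₁, Equiv.symm_apply_apply,
    hrow, bb_permanent_border_updateRow_inl, sp_border_smul, permanent_smul, permanent_smul, map_pow]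
  simp only [Fintype.card_fin, Fintype.card_sum, Fintype.card_unit]
  ring

/-- **`ε`-expansion, part (d), block-2 row**: `per(P⁺; row k ← row N) = C(e³)·(2 Λ₁ R²⁰_k + C e · (per B₁ · Z²⁰_k))`. [this crux] -/
theorem sp_member_d_inr (t c₂ : ℕ → ℕ → Fin 3 → S) (e : S) (n₁ N₁ : ℕ) (hN₁ : n₁ + 1 ≤ N₁) (h22 : ∀ (i j : ℕ) (s : Fin 3), i < 3 → j < 3 → i ≠ j → t (N₁ + i) (N₁ + j) s = e * c₂ i j s) (h2c : ∀ (i : ℕ) (s : Fin 3), i < 3 → t (N₁ + i) (N₁ + 3) s = e * c₂ i 3 s) (h2r : ∀ (j : ℕ) (s : Fin 3), j < 3 → t (N₁ + 3) (N₁ + j) s = e * c₂ 3 j s) (h12 : ∀ (i j : ℕ) (s : Fin 3), i < N₁ → j < 3 → t i (N₁ + j) s = 0) (h21 : ∀ (i j : ℕ) (s : Fin 3), i < 3 → j < N₁ → t (N₁ + i) j s = 0) (k₂ : Fin 3) :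
    (((Matrix.of fun i j : Fin (N₁ + 3 + 1) => (fun ij : Fin (N₁ + 3 + 1) × Fin (N₁ + 3 + 1) => ∑ s : Fin 3, (if ((ij.1 : ℕ) = (ij.2 : ℕ) ∧ n₁ + 1 ≤ (ij.1 : ℕ)) then (0 : S) else t (ij.1 : ℕ) (ij.2 : ℕ) s) • (X s : MvPolynomial (Fin 3) S)) (i, j))).updateRow (Fin.castSucc ((finSumFinEquiv : Fin N₁ ⊕ Fin 3 ≃ Fin (N₁ + 3)) (Sum.inr k₂))) (((Matrix.of fun i j : Fin (N₁ + 3 + 1) => (fun ij : Fin (N₁ + 3 + 1) × Fin (N₁ + 3 + 1) => ∑ s : Fin 3, (if ((ij.1 : ℕ) = (ij.2 : ℕ) ∧ n₁ + 1 ≤ (ij.1 : ℕ)) then (0 : S) else t (ij.1 : ℕ) (ij.2 : ℕ) s) • (X s : MvPolynomial (Fin 3) S)) (i, j))) (Fin.last (N₁ + 3)))).permanent =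
      C (e ^ 3) * (2 * ((Matrix.fromBlocks (Matrix.of fun i j : Fin (N₁) => (fun ij : Fin (N₁) × Fin (N₁) => ∑ s : Fin 3, (if ((ij.1 : ℕ) = (ij.2 : ℕ) ∧ n₁ + 1 ≤ (ij.1 : ℕ)) then (0 : S) else t (ij.1 : ℕ) (ij.2 : ℕ) s) • (X s : MvPolynomial (Fin 3) S)) (i, j)) (Matrix.of fun (i : Fin N₁) (_ : Unit) => (fun i : Fin N₁ => ∑ s : Fin 3, t ((i : Fin N₁) : ℕ) (N₁ + 3) s • (X s : MvPolynomial (Fin 3) S)) i) (Matrix.of fun (_ : Unit) (j : Fin N₁) => (fun l : Fin N₁ => ∑ s : Fin 3, t (N₁ + 3) ((l : Fin N₁) : ℕ) s • (X s : MvPolynomial (Fin 3) S)) j) (0 : Matrix Unit Unit (MvPolynomial (Fin 3) S)))).permanent * (((Matrix.of fun i j : Fin 3 => ∑ s : Fin 3, (if i = j then (0 : S) else c₂ (i : ℕ) (j : ℕ) s) • (X s : MvPolynomial (Fin 3) S))).updateRow k₂ (fun l : Fin 3 => ∑ s : Fin 3, c₂ 3 ((l : Fin 3) : ℕ) s • (X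 s : MvPolynomial (Fin 3) S))).permanent +
        C e * (((Matrix.of fun i j : Fin (N₁) => (fun ij : Fin (N₁) × Fin (N₁) => ∑ s : Fin 3, (if ((ij.1 : ℕ) = (ij.2 : ℕ) ∧ n₁ + 1 ≤ (ij.1 : ℕ)) then (0 : S) else t (ij.1 : ℕ) (ij.2 : ℕ) s) • (X s : MvPolynomial (Fin 3) S)) (i, j))).permanent * (((Matrix.fromBlocks (Matrix.of fun i j : Fin 3 => ∑ s : Fin 3, (if i = j then (0 : S) else c₂ (i : ℕ) (j : ℕ) s) • (X s : MvPolynomial (Fin 3) S)) (Matrix.of fun (i : Fin 3) (_ : Unit) => (fun i : Fin 3 => ∑ s : Fin 3, c₂ ((i : Fin 3) : ℕ) 3 s • (X s : MvPolynomial (Fin 3) S)) i) (Matrix.of fun (_ : Unit) (j : Fin 3) => (fun l : Fin 3 => ∑ s : Fin 3, c₂ 3 ((l : Fin 3) : ℕ) s • (X s : MvPolynomial (Fin 3) S)) j) (0 : Matrix Unit Unit (MvPolynomial (Fin 3) S)))).updateRow (Sum.inl k₂) (((Matrix.fromBlocks (Matrix.of fun i j : Fin 3 => ∑ s : Fin 3,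 (if i = j then (0 : S) else c₂ (i : ℕ) (j : ℕ) s) • (X s : MvPolynomial (Fin 3) S)) (Matrix.of fun (i : Fin 3) (_ : Unit) => (fun i : Fin 3 => ∑ s : Fin 3, c₂ ((i : Fin 3) : ℕ) 3 s • (X s : MvPolynomial (Fin 3) S)) i) (Matrix.of fun (_ : Unit) (j : Fin 3) => (fun l : Fin 3 => ∑ s : Fin 3, c₂ 3 ((l : Fin 3) : ℕ) s • (X s : MvPolynomial (Fin 3) S)) j) (0 : Matrix Unit Unit (MvPolynomial (Fin 3) S)))) (Sum.inr ()))).permanent)) := by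
  have hform := sp_pencil_border_blockForm t c₂ e n₁ N₁ hN₁ h22 h2c h2r h12 h21
  have hrow : (fun j => ((Matrix.of fun i j : Fin (N₁ + 3 + 1) => (fun ij : Fin (N₁ + 3 + 1) × Fin (N₁ + 3 + 1) => ∑ s : Fin 3, (if ((ij.1 : ℕ) = (ij.2 : ℕ) ∧ n₁ + 1 ≤ (ij.1 : ℕ)) then (0 : S) else t (ij.1 : ℕ) (ij.2 : ℕ) s) • (X s : MvPolynomial (Fin 3) S)) (i, j))) (Fin.last (N₁ + 3)) (((((finSumFinEquiv : Fin N₁ ⊕ Fin 3 ≃ Fin (N₁ + 3)).sumCongr (Equiv.ofUnique Unit (Fin 1))).trans (finSumFinEquiv : Fin (N₁ + 3) ⊕ Fin 1 ≃ Fin (N₁ + 3 + 1)))) j)) = ((Matrix.fromBlocks (Matrix.fromBlocks (Matrix.of fun i j : Fin (N₁) => (fun ij : Fin (N₁) × Fin (N₁) => ∑ s : Fin 3, (if ((ij.1 : ℕ) = (ij.2 : ℕ) ∧ n₁ + 1 ≤ (ij.1 : ℕ)) then (0 : S) else t (ij.1 : ℕ) (ij.2 : ℕ) s) • (X s : MvPolynomial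 (Fin 3) S)) (i, j)) 0 0 ((C e : MvPolynomial (Fin 3) S) • (Matrix.of fun i j : Fin 3 => ∑ s : Fin 3, (if i = j then (0 : S) else c₂ (i : ℕ) (j : ℕ) s) • (X s : MvPolynomial (Fin 3) S)))) (Matrix.of fun (i : Fin N₁ ⊕ Fin 3) (_ : Unit) => Sum.elim (fun i : Fin N₁ => ∑ s : Fin 3, t ((i : Fin N₁) : ℕ) (N₁ + 3) s • (X s : MvPolynomial (Fin 3) S)) ((C e : MvPolynomial (Fin 3) S) • (fun i : Fin 3 => ∑ s : Fin 3, c₂ ((i : Fin 3) : ℕ) 3 s • (X s : MvPolynomial (Fin 3) S))) i) (Matrix.of fun (_ : Unit) (j : Fin N₁ ⊕ Fin 3) => Sum.elim (fun l : Fin N₁ => ∑ s : Fin 3, t (N₁ + 3) ((l : Fin N₁) : ℕ) s • (X s : MvPolynomial (Fin 3) S)) ((C e : MvPolynomial (Fin 3) S) • (fun l : Fin 3 => ∑ s : Fin 3, c₂ 3 ((l : Fin 3) : ℕ) s • (X s : MvPolynomial (Fin 3) S))) j) (0 : Matrix Unit Unit (MvPolynomial (Fin 3) S)))) (Sum.inr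 ()) := by
    rw [← hform]
    funext j
    simp only [Matrix.submatrix_apply, sp_ge_inr]
  have hsc : (((C e : MvPolynomial (Fin 3) S)) • ((Matrix.fromBlocks (Matrix.of fun i j : Fin 3 => ∑ s : Fin 3, (if i = j then (0 : S) else c₂ (i : ℕ) (j : ℕ) s) • (X s : MvPolynomial (Fin 3) S)) (Matrix.of fun (i : Fin 3) (_ : Unit) => (fun i : Fin 3 => ∑ s : Fin 3, c₂ ((i : Fin 3) : ℕ) 3 s • (X s : MvPolynomial (Fin 3) S)) i) (Matrix.of fun (_ : Unit) (j : Fin 3) => (fun l : Fin 3 => ∑ s : Fin 3, c₂ 3 ((l : Fin 3) : ℕ) s • (X s : MvPolynomial (Fin 3) S)) j) (0 : Matrix Unit Unit (MvPolynomial (Fin 3) S))))).updateRow (Sum.inl k₂) ((((C e : MvPolynomial (Fin 3) S)) • ((Matrix.fromBlocks (Matrix.of fun i j : Fin 3 => ∑ s : Fin 3, (if i = j then (0 : S) else c₂ (i : ℕ) (j : ℕ) s) • (X s : MvPolynomial (Fin 3) S)) (Matrix.of fun (i : Fin 3) (_ : Unit) => (fun i : Fin 3 => ∑ s : Fin 3,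 c₂ ((i : Fin 3) : ℕ) 3 s • (X s : MvPolynomial (Fin 3) S)) i) (Matrix.of fun (_ : Unit) (j : Fin 3) => (fun l : Fin 3 => ∑ s : Fin 3, c₂ 3 ((l : Fin 3) : ℕ) s • (X s : MvPolynomial (Fin 3) S)) j) (0 : Matrix Unit Unit (MvPolynomial (Fin 3) S))))) (Sum.inr ())) =
      ((C e : MvPolynomial (Fin 3) S)) • (((Matrix.fromBlocks (Matrix.of fun i j : Fin 3 => ∑ s : Fin 3, (if i = j then (0 : S) else c₂ (i : ℕ) (j : ℕ) s) • (X s : MvPolynomial (Fin 3) S)) (Matrix.of fun (i : Fin 3) (_ : Unit) => (fun i : Fin 3 => ∑ s : Fin 3, c₂ ((i : Fin 3) : ℕ) 3 s • (X s : MvPolynomial (Fin 3) S)) i) (Matrix.of fun (_ : Unit) (j : Fin 3) => (fun l : Fin 3 => ∑ s : Fin 3, c₂ 3 ((l : Fin 3) : ℕ) s • (X s : MvPolynomial (Fin 3) S)) j) (0 : Matrix Unit Unit (MvPolynomial (Fin 3) S)))).updateRow (Sum.inl k₂) (((Matrix.fromBlocks (Matrix.of fun i j : Fin 3 => ∑ s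 : Fin 3, (if i = j then (0 : S) else c₂ (i : ℕ) (j : ℕ) s) • (X s : MvPolynomial (Fin 3) S)) (Matrix.of fun (i : Fin 3) (_ : Unit) => (fun i : Fin 3 => ∑ s : Fin 3, c₂ ((i : Fin 3) : ℕ) 3 s • (X s : MvPolynomial (Fin 3) S)) i) (Matrix.of fun (_ : Unit) (j : Fin 3) => (fun l : Fin 3 => ∑ s : Fin 3, c₂ 3 ((l : Fin 3) : ℕ) s • (X s : MvPolynomial (Fin 3) S)) j) (0 : Matrix Unit Unit (MvPolynomial (Fin 3) S)))) (Sum.inr ()))) := by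
    rw [← sp_updateRow_smul]
    rfl
  rw [← permanent_submatrix_equiv (((finSumFinEquiv : Fin N₁ ⊕ Fin 3 ≃ Fin (N₁ + 3)).sumCongr (Equiv.ofUnique Unit (Fin 1))).trans (finSumFinEquiv : Fin (N₁ + 3) ⊕ Fin 1 ≃ Fin (N₁ + 3 + 1))), submatrix_updateRow_equiv, hform, ← sp_ge_inl_inr N₁ k₂, Equiv.symm_apply_apply,
    hrow, bb_permanent_border_updateRow_inr, sp_border_smul, hsc, sp_updateRow_smul, permanent_smul, permanent_smul,
    map_pow]
  simp only [Fintype.card_fin, Fintype.card_sum, Fintype.card_unit]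
  ring

/-- **`ε`-expansion, part (e), block-1 column.** [this crux] -/
theorem sp_member_e_inl (t c₂ : ℕ → ℕ → Fin 3 → S) (e : S) (n₁ N₁ : ℕ) (hN₁ : n₁ + 1 ≤ N₁) (h22 : ∀ (i j : ℕ) (s : Fin 3), i < 3 → j < 3 → i ≠ j → t (N₁ + i) (N₁ + j) s = e * c₂ i j s) (h2c : ∀ (i : ℕ) (s : Fin 3), i < 3 → t (N₁ + i) (N₁ + 3) s = e * c₂ i 3 s) (h2r : ∀ (j : ℕ) (s : Fin 3), j < 3 → t (N₁ + 3) (N₁ + j) s = e * c₂ 3 j s) (h12 : ∀ (i j : ℕ) (s : Fin 3), i < N₁ → j < 3 → t i (N₁ + j) s = 0) (h21 : ∀ (i j : ℕ) (s : Fin 3), i < 3 → j < N₁ → t (N₁ + i) j s = 0) (l₁ : Fin N₁) :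
    (((Matrix.of fun i j : Fin (N₁ + 3 + 1) => (fun ij : Fin (N₁ + 3 + 1) × Fin (N₁ + 3 + 1) => ∑ s : Fin 3, (if ((ij.1 : ℕ) = (ij.2 : ℕ) ∧ n₁ + 1 ≤ (ij.1 : ℕ)) then (0 : S) else t (ij.1 : ℕ) (ij.2 : ℕ) s) • (X s : MvPolynomial (Fin 3) S)) (i, j))).updateCol (Fin.castSucc ((finSumFinEquiv : Fin N₁ ⊕ Fin 3 ≃ Fin (N₁ + 3)) (Sum.inl l₁))) (fun i => ((Matrix.of fun i j : Fin (N₁ + 3 + 1) => (fun ij : Fin (N₁ + 3 + 1) × Fin (N₁ + 3 + 1) => ∑ s : Fin 3, (if ((ij.1 : ℕ) = (ij.2 : ℕ) ∧ n₁ + 1 ≤ (ij.1 : ℕ)) then (0 : S) else t (ij.1 : ℕ) (ij.2 : ℕ) s) • (X s : MvPolynomial (Fin 3) S)) (i, j))) i (Fin.last (N₁ + 3)))).permanent =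
      C (e ^ 3) * (((Matrix.of fun i j : Fin 3 => ∑ s : Fin 3, (if i = j then (0 : S) else c₂ (i : ℕ) (j : ℕ) s) • (X s : MvPolynomial (Fin 3) S))).permanent * (((Matrix.fromBlocks (Matrix.of fun i j : Fin (N₁) => (fun ij : Fin (N₁) × Fin (N₁) => ∑ s : Fin 3, (if ((ij.1 : ℕ) = (ij.2 : ℕ) ∧ n₁ + 1 ≤ (ij.1 : ℕ)) then (0 : S) else t (ij.1 : ℕ) (ij.2 : ℕ) s) • (X s : MvPolynomial (Fin 3) S)) (i, j)) (Matrix.of fun (i : Fin N₁) (_ : Unit) => (fun i : Fin N₁ => ∑ s : Fin 3, t ((i : Fin N₁) : ℕ) (N₁ + 3) s • (X s : MvPolynomial (Fin 3) S)) i) (Matrix.of fun (_ : Unit) (j : Fin N₁) => (fun l : Fin N₁ => ∑ s : Fin 3, t (N₁ + 3) ((l : Fin N₁) : ℕ) s • (X s : MvPolynomial (Fin 3) S)) j) (0 : Matrix Unit Unit (MvPolynomial (Fin 3) S)))).updateCol (Sum.inl l₁) (fun i => ((Matrix.fromBlocks (Matrix.of fun i j : Fin (N₁) => (fun ij : Fin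 (N₁) × Fin (N₁) => ∑ s : Fin 3, (if ((ij.1 : ℕ) = (ij.2 : ℕ) ∧ n₁ + 1 ≤ (ij.1 : ℕ)) then (0 : S) else t (ij.1 : ℕ) (ij.2 : ℕ) s) • (X s : MvPolynomial (Fin 3) S)) (i, j)) (Matrix.of fun (i : Fin N₁) (_ : Unit) => (fun i : Fin N₁ => ∑ s : Fin 3, t ((i : Fin N₁) : ℕ) (N₁ + 3) s • (X s : MvPolynomial (Fin 3) S)) i) (Matrix.of fun (_ : Unit) (j : Fin N₁) => (fun l : Fin N₁ => ∑ s : Fin 3, t (N₁ + 3) ((l : Fin N₁) : ℕ) s • (X s : MvPolynomial (Fin 3) S)) j) (0 : Matrix Unit Unit (MvPolynomial (Fin 3) S)))) i (Sum.inr ()))).permanent +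
        C e * (2 * (((Matrix.of fun i j : Fin (N₁) => (fun ij : Fin (N₁) × Fin (N₁) => ∑ s : Fin 3, (if ((ij.1 : ℕ) = (ij.2 : ℕ) ∧ n₁ + 1 ≤ (ij.1 : ℕ)) then (0 : S) else t (ij.1 : ℕ) (ij.2 : ℕ) s) • (X s : MvPolynomial (Fin 3) S)) (i, j))).updateCol l₁ (fun i : Fin N₁ => ∑ s : Fin 3, t ((i : Fin N₁) : ℕ) (N₁ + 3) s • (X s : MvPolynomial (Fin 3) S))).permanent * ((Matrix.fromBlocks (Matrix.of fun i j : Fin 3 => ∑ s : Fin 3, (if i = j then (0 : S) else c₂ (i : ℕ) (j : ℕ) s) • (X s : MvPolynomial (Fin 3) S)) (Matrix.of fun (i : Fin 3) (_ : Unit) => (fun i : Fin 3 => ∑ s : Fin 3, c₂ ((i : Fin 3) : ℕ) 3 s • (X s : MvPolynomial (Fin 3) S)) i) (Matrix.of fun (_ : Unit) (j : Fin 3) => (fun l : Fin 3 => ∑ s : Fin 3, c₂ 3 ((l : Fin 3) : ℕ) s • (X s : MvPolynomial (Fin 3) S)) j) (0 : Matrix Unit Unit (MvPolynomial (Fin 3)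 S)))).permanent)) := by
  have hform := sp_pencil_border_blockForm t c₂ e n₁ N₁ hN₁ h22 h2c h2r h12 h21
  have hcol : (fun i => ((Matrix.of fun i j : Fin (N₁ + 3 + 1) => (fun ij : Fin (N₁ + 3 + 1) × Fin (N₁ + 3 + 1) => ∑ s : Fin 3, (if ((ij.1 : ℕ) = (ij.2 : ℕ) ∧ n₁ + 1 ≤ (ij.1 : ℕ)) then (0 : S) else t (ij.1 : ℕ) (ij.2 : ℕ) s) • (X s : MvPolynomial (Fin 3) S)) (i, j))) (((((finSumFinEquiv : Fin N₁ ⊕ Fin 3 ≃ Fin (N₁ + 3)).sumCongr (Equiv.ofUnique Unit (Fin 1))).trans (finSumFinEquiv : Fin (N₁ + 3) ⊕ Fin 1 ≃ Fin (N₁ + 3 + 1)))) i) (Fin.last (N₁ + 3))) = fun i => ((Matrix.fromBlocks (Matrix.fromBlocks (Matrix.of fun i j : Fin (N₁) => (fun ij : Fin (N₁) × Fin (N₁) => ∑ s : Fin 3, (if ((ij.1 : ℕ) = (ij.2 : ℕ) ∧ n₁ + 1 ≤ (ij.1 : ℕ)) then (0 : S) else t (ij.1 : ℕ) (ij.2 :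 ℕ) s) • (X s : MvPolynomial (Fin 3) S)) (i, j)) 0 0 ((C e : MvPolynomial (Fin 3) S) • (Matrix.of fun i j : Fin 3 => ∑ s : Fin 3, (if i = j then (0 : S) else c₂ (i : ℕ) (j : ℕ) s) • (X s : MvPolynomial (Fin 3) S)))) (Matrix.of fun (i : Fin N₁ ⊕ Fin 3) (_ : Unit) => Sum.elim (fun i : Fin N₁ => ∑ s : Fin 3, t ((i : Fin N₁) : ℕ) (N₁ + 3) s • (X s : MvPolynomial (Fin 3) S)) ((C e : MvPolynomial (Fin 3) S) • (fun i : Fin 3 => ∑ s : Fin 3, c₂ ((i : Fin 3) : ℕ) 3 s • (X s : MvPolynomial (Fin 3) S))) i) (Matrix.of fun (_ : Unit) (j : Fin N₁ ⊕ Fin 3) => Sum.elim (fun l : Fin N₁ => ∑ s : Fin 3, t (N₁ + 3) ((l : Fin N₁) : ℕ) s • (X s : MvPolynomial (Fin 3) S)) ((C e : MvPolynomial (Fin 3) S) • (fun l : Fin 3 => ∑ s : Fin 3, c₂ 3 ((l : Fin 3) : ℕ) s • (X s : MvPolynomial (Fin 3) S))) j) (0 : Matrix Unit Unit (MvPolynomial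 (Fin 3) S)))) i (Sum.inr ()) := by
    rw [← hform]
    funext i
    simp only [Matrix.submatrix_apply, sp_ge_inr]
  rw [← permanent_submatrix_equiv (((finSumFinEquiv : Fin N₁ ⊕ Fin 3 ≃ Fin (N₁ + 3)).sumCongr (Equiv.ofUnique Unit (Fin 1))).trans (finSumFinEquiv : Fin (N₁ + 3) ⊕ Fin 1 ≃ Fin (N₁ + 3 + 1))), submatrix_updateCol_equiv, hform, ← sp_ge_inl_inl N₁ l₁, Equiv.symm_apply_apply,
    hcol, bb_permanent_border_updateCol_inl, sp_border_smul, permanent_smul, permanent_smul, map_pow]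
  simp only [Fintype.card_fin, Fintype.card_sum, Fintype.card_unit]
  ring

/-- **`ε`-expansion, part (e), block-2 column.** [this crux] -/
theorem sp_member_e_inr (t c₂ : ℕ → ℕ → Fin 3 → S) (e : S) (n₁ N₁ : ℕ) (hN₁ : n₁ + 1 ≤ N₁) (h22 : ∀ (i j : ℕ) (s : Fin 3), i < 3 → j < 3 → i ≠ j → t (N₁ + i) (N₁ + j) s = e * c₂ i j s) (h2c : ∀ (i : ℕ) (s : Fin 3), i < 3 → t (N₁ + i) (N₁ + 3) s = e * c₂ i 3 s) (h2r : ∀ (j : ℕ) (s : Fin 3), j < 3 → t (N₁ + 3) (N₁ + j) s = e * c₂ 3 j s) (h12 : ∀ (i j : ℕ) (s : Fin 3), i < N₁ → j < 3 → t i (N₁ + j) s = 0) (h21 : ∀ (i j : ℕ) (s : Fin 3), i < 3 → j < N₁ → t (N₁ + i) j s = 0) (l₂ : Fin 3) :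
    (((Matrix.of fun i j : Fin (N₁ + 3 + 1) => (fun ij : Fin (N₁ + 3 + 1) × Fin (N₁ + 3 + 1) => ∑ s : Fin 3, (if ((ij.1 : ℕ) = (ij.2 : ℕ) ∧ n₁ + 1 ≤ (ij.1 : ℕ)) then (0 : S) else t (ij.1 : ℕ) (ij.2 : ℕ) s) • (X s : MvPolynomial (Fin 3) S)) (i, j))).updateCol (Fin.castSucc ((finSumFinEquiv : Fin N₁ ⊕ Fin 3 ≃ Fin (N₁ + 3)) (Sum.inr l₂))) (fun i => ((Matrix.of fun i j : Fin (N₁ + 3 + 1) => (fun ij : Fin (N₁ + 3 + 1) × Fin (N₁ + 3 + 1) => ∑ s : Fin 3, (if ((ij.1 : ℕ) = (ij.2 : ℕ) ∧ n₁ + 1 ≤ (ij.1 : ℕ)) then (0 : S) else t (ij.1 : ℕ) (ij.2 : ℕ) s) • (X s : MvPolynomial (Fin 3) S)) (i, j))) i (Fin.last (N₁ + 3)))).permanent =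
      C (e ^ 3) * (2 * ((Matrix.fromBlocks (Matrix.of fun i j : Fin (N₁) => (fun ij : Fin (N₁) × Fin (N₁) => ∑ s : Fin 3, (if ((ij.1 : ℕ) = (ij.2 : ℕ) ∧ n₁ + 1 ≤ (ij.1 : ℕ)) then (0 : S) else t (ij.1 : ℕ) (ij.2 : ℕ) s) • (X s : MvPolynomial (Fin 3) S)) (i, j)) (Matrix.of fun (i : Fin N₁) (_ : Unit) => (fun i : Fin N₁ => ∑ s : Fin 3, t ((i : Fin N₁) : ℕ) (N₁ + 3) s • (X s : MvPolynomial (Fin 3) S)) i) (Matrix.of fun (_ : Unit) (j : Fin N₁) => (fun l : Fin N₁ => ∑ s : Fin 3, t (N₁ + 3) ((l : Fin N₁) : ℕ) s • (X s : MvPolynomial (Fin 3) S)) j) (0 : Matrix Unit Unit (MvPolynomial (Fin 3) S)))).permanent * (((Matrix.of fun i j : Fin 3 => ∑ s : Fin 3, (if i = j then (0 : S) else c₂ (i : ℕ) (j : ℕ) s) • (X s : MvPolynomial (Fin 3) S))).updateCol l₂ (fun i : Fin 3 => ∑ s : Fin 3, c₂ ((i : Fin 3) : ℕ) 3 s • (X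 s : MvPolynomial (Fin 3) S))).permanent +
        C e * (((Matrix.of fun i j : Fin (N₁) => (fun ij : Fin (N₁) × Fin (N₁) => ∑ s : Fin 3, (if ((ij.1 : ℕ) = (ij.2 : ℕ) ∧ n₁ + 1 ≤ (ij.1 : ℕ)) then (0 : S) else t (ij.1 : ℕ) (ij.2 : ℕ) s) • (X s : MvPolynomial (Fin 3) S)) (i, j))).permanent * (((Matrix.fromBlocks (Matrix.of fun i j : Fin 3 => ∑ s : Fin 3, (if i = j then (0 : S) else c₂ (i : ℕ) (j : ℕ) s) • (X s : MvPolynomial (Fin 3) S)) (Matrix.of fun (i : Fin 3) (_ : Unit) => (fun i : Fin 3 => ∑ s : Fin 3, c₂ ((i : Fin 3) : ℕ) 3 s • (X s : MvPolynomial (Fin 3) S)) i) (Matrix.of fun (_ : Unit) (j : Fin 3) => (fun l : Fin 3 => ∑ s : Fin 3, c₂ 3 ((l : Fin 3) : ℕ) s • (X s : MvPolynomial (Fin 3) S)) j) (0 : Matrix Unit Unit (MvPolynomial (Fin 3) S)))).updateCol (Sum.inl l₂) (fun i => ((Matrix.fromBlocks (Matrix.of fun i j : Fin 3 => ∑ s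 : Fin 3, (if i = j then (0 : S) else c₂ (i : ℕ) (j : ℕ) s) • (X s : MvPolynomial (Fin 3) S)) (Matrix.of fun (i : Fin 3) (_ : Unit) => (fun i : Fin 3 => ∑ s : Fin 3, c₂ ((i : Fin 3) : ℕ) 3 s • (X s : MvPolynomial (Fin 3) S)) i) (Matrix.of fun (_ : Unit) (j : Fin 3) => (fun l : Fin 3 => ∑ s : Fin 3, c₂ 3 ((l : Fin 3) : ℕ) s • (X s : MvPolynomial (Fin 3) S)) j) (0 : Matrix Unit Unit (MvPolynomial (Fin 3) S)))) i (Sum.inr ()))).permanent)) := by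
  have hform := sp_pencil_border_blockForm t c₂ e n₁ N₁ hN₁ h22 h2c h2r h12 h21
  have hcol : (fun i => ((Matrix.of fun i j : Fin (N₁ + 3 + 1) => (fun ij : Fin (N₁ + 3 + 1) × Fin (N₁ + 3 + 1) => ∑ s : Fin 3, (if ((ij.1 : ℕ) = (ij.2 : ℕ) ∧ n₁ + 1 ≤ (ij.1 : ℕ)) then (0 : S) else t (ij.1 : ℕ) (ij.2 : ℕ) s) • (X s : MvPolynomial (Fin 3) S)) (i, j))) (((((finSumFinEquiv : Fin N₁ ⊕ Fin 3 ≃ Fin (N₁ + 3)).sumCongr (Equiv.ofUnique Unit (Fin 1))).trans (finSumFinEquiv : Fin (N₁ + 3) ⊕ Fin 1 ≃ Fin (N₁ + 3 + 1)))) i) (Fin.last (N₁ + 3))) = fun i => ((Matrix.fromBlocks (Matrix.fromBlocks (Matrix.of fun i j : Fin (N₁) => (fun ij : Fin (N₁) × Fin (N₁) => ∑ s : Fin 3, (if ((ij.1 : ℕ) = (ij.2 : ℕ) ∧ n₁ + 1 ≤ (ij.1 : ℕ)) then (0 : S) else t (ij.1 : ℕ) (ij.2 : ℕ) s) • (X s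 : MvPolynomial (Fin 3) S)) (i, j)) 0 0 ((C e : MvPolynomial (Fin 3) S) • (Matrix.of fun i j : Fin 3 => ∑ s : Fin 3, (if i = j then (0 : S) else c₂ (i : ℕ) (j : ℕ) s) • (X s : MvPolynomial (Fin 3) S)))) (Matrix.of fun (i : Fin N₁ ⊕ Fin 3) (_ : Unit) => Sum.elim (fun i : Fin N₁ => ∑ s : Fin 3, t ((i : Fin N₁) : ℕ) (N₁ + 3) s • (X s : MvPolynomial (Fin 3) S)) ((C e : MvPolynomial (Fin 3) S) • (fun i : Fin 3 => ∑ s : Fin 3, c₂ ((i : Fin 3) : ℕ) 3 s • (X s : MvPolynomial (Fin 3) S))) i) (Matrix.of fun (_ : Unit) (j : Fin N₁ ⊕ Fin 3) => Sum.elim (fun l : Fin N₁ => ∑ s : Fin 3, t (N₁ + 3) ((l : Fin N₁) : ℕ) s • (X s : MvPolynomial (Fin 3) S)) ((C e : MvPolynomial (Fin 3) S) • (fun l : Fin 3 => ∑ s : Fin 3, c₂ 3 ((l : Fin 3) : ℕ) s • (X s : MvPolynomial (Fin 3) S))) j) (0 : Matrix Unit Unit (MvPolynomial (Fin 3) S))))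 i (Sum.inr ()) := by
    rw [← hform]
    funext i
    simp only [Matrix.submatrix_apply, sp_ge_inr]
  have hsc : (((C e : MvPolynomial (Fin 3) S)) • ((Matrix.fromBlocks (Matrix.of fun i j : Fin 3 => ∑ s : Fin 3, (if i = j then (0 : S) else c₂ (i : ℕ) (j : ℕ) s) • (X s : MvPolynomial (Fin 3) S)) (Matrix.of fun (i : Fin 3) (_ : Unit) => (fun i : Fin 3 => ∑ s : Fin 3, c₂ ((i : Fin 3) : ℕ) 3 s • (X s : MvPolynomial (Fin 3) S)) i) (Matrix.of fun (_ : Unit) (j : Fin 3) => (fun l : Fin 3 => ∑ s : Fin 3, c₂ 3 ((l : Fin 3) : ℕ) s • (X s : MvPolynomial (Fin 3) S)) j) (0 : Matrix Unit Unit (MvPolynomial (Fin 3) S))))).updateCol (Sum.inl l₂) (fun i => (((C e : MvPolynomial (Fin 3) S)) • ((Matrix.fromBlocks (Matrix.of fun i j : Fin 3 => ∑ s : Fin 3, (if i = j then (0 : S) else c₂ (i : ℕ) (j : ℕ) s) • (X s : MvPolynomial (Fin 3) S)) (Matrix.of fun (i : Fin 3) (_ : Unit) => (fun i : Fin 3 =>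 ∑ s : Fin 3, c₂ ((i : Fin 3) : ℕ) 3 s • (X s : MvPolynomial (Fin 3) S)) i) (Matrix.of fun (_ : Unit) (j : Fin 3) => (fun l : Fin 3 => ∑ s : Fin 3, c₂ 3 ((l : Fin 3) : ℕ) s • (X s : MvPolynomial (Fin 3) S)) j) (0 : Matrix Unit Unit (MvPolynomial (Fin 3) S))))) i (Sum.inr ())) =
      ((C e : MvPolynomial (Fin 3) S)) • (((Matrix.fromBlocks (Matrix.of fun i j : Fin 3 => ∑ s : Fin 3, (if i = j then (0 : S) else c₂ (i : ℕ) (j : ℕ) s) • (X s : MvPolynomial (Fin 3) S)) (Matrix.of fun (i : Fin 3) (_ : Unit) => (fun i : Fin 3 => ∑ s : Fin 3, c₂ ((i : Fin 3) : ℕ) 3 s • (X s : MvPolynomial (Fin 3) S)) i) (Matrix.of fun (_ : Unit) (j : Fin 3) => (fun l : Fin 3 => ∑ s : Fin 3, c₂ 3 ((l : Fin 3) : ℕ) s • (X s : MvPolynomial (Fin 3) S)) j) (0 : Matrix Unit Unit (MvPolynomial (Fin 3) S)))).updateCol (Sum.inl l₂) (fun i => ((Matrix.fromBlocks (Matrix.of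 fun i j : Fin 3 => ∑ s : Fin 3, (if i = j then (0 : S) else c₂ (i : ℕ) (j : ℕ) s) • (X s : MvPolynomial (Fin 3) S)) (Matrix.of fun (i : Fin 3) (_ : Unit) => (fun i : Fin 3 => ∑ s : Fin 3, c₂ ((i : Fin 3) : ℕ) 3 s • (X s : MvPolynomial (Fin 3) S)) i) (Matrix.of fun (_ : Unit) (j : Fin 3) => (fun l : Fin 3 => ∑ s : Fin 3, c₂ 3 ((l : Fin 3) : ℕ) s • (X s : MvPolynomial (Fin 3) S)) j) (0 : Matrix Unit Unit (MvPolynomial (Fin 3) S)))) i (Sum.inr ()))) := by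
    rw [← sp_updateCol_smul]
    rfl
  rw [← permanent_submatrix_equiv (((finSumFinEquiv : Fin N₁ ⊕ Fin 3 ≃ Fin (N₁ + 3)).sumCongr (Equiv.ofUnique Unit (Fin 1))).trans (finSumFinEquiv : Fin (N₁ + 3) ⊕ Fin 1 ≃ Fin (N₁ + 3 + 1))), submatrix_updateCol_equiv, hform, ← sp_ge_inl_inr N₁ l₂, Equiv.symm_apply_apply,
    hcol, bb_permanent_border_updateCol_inr, sp_border_smul, hsc, sp_updateCol_smul, permanent_smul, permanent_smul,
    map_pow]
  simp only [Fintype.card_fin, Fintype.card_sum, Fintype.card_unit]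
  ring

end Spec

end Summit.ValiantsHypothesis.ValiantsHypothesis.Theorems.ValuativeFlip
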